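import Literature.AlgebraicGeometry.Resolution.LocalBlowup
import Literature.AlgebraicGeometry.Resolution.RankOneReduction
import HarnessLib

/-!
# Local uniformization of `k`-models: towers of local blowing ups vs. finitely generated models

Topic: `Literature/AlgebraicGeometry/Resolution`. The module docstring of `RankOneReduction.lean`
translates Novacoski–Spivakovsky's Local Uniformization Property (arXiv:1204.4751, Def. 2.20: a
finite sequence of local blowing ups with respect to `ν` ending in a regular local ring) into
the finitely-generated-model form `RelLocalUniformization k K O` ("`R ≤ A ⊆ O`, `A` finitely
generated over `k`, `A` regular at the centre"), arguing informally that towers compose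
(Lemma 2.9) and that one such `A` is one local blowing up (Def. 2.8/2.11). With the local
blowing ups of `LocalBlowup.lean` this translation is PROVED here:

* `closure_subalgebra_union_eq` — `Subring.closure (R ∪ t) = (Algebra.adjoin k (R ∪ t)).toSubring`
  for a `k`-subalgebra `R` of `K`;
* `towerLU_iff_fgModel` — for a finitely generated `k`-subalgebra `R ⊆ O` of `K`: some tower of
  local blowing ups with respect to `O` starting at `R` ends with a regular local ring iff some
  finitely generated `k`-subalgebra `R ≤ A ⊆ O` is regular at the centre `𝔪_O ∩ A`;
* `relLocalUniformization_iff_towers` — hence `RelLocalUniformization k K O` is literally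
  Def. 2.20 for `ν_O` at every finitely generated model `R ⊆ O` of `K/k`.

## Sources

* J. Novacoski, M. Spivakovsky, arXiv:1204.4751, Defs. 2.8, 2.11, 2.20, Lemma 2.9.
  [NovacoskiSpivakovsky2014]
-/

noncomputable section

namespace Literature.AlgebraicGeometry.Resolution

variable {k K : Type} [Field k] [Field K] [Algebra k K]

/-- For a `k`-subalgebra `R` of `K` and `t ⊆ K`, the subring generated by `R ∪ t` is the
`k`-subalgebra generated by `R ∪ t` (the scalars `k` already lie in `R`). [folklore] -/
theorem closure_subalgebra_union_eq (R : Subalgebra k K) (t : Set K) :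
    Subring.closure ((R : Set K) ∪ t) = (Algebra.adjoin k ((R : Set K) ∪ t)).toSubring := by
  rw [Algebra.adjoin_eq_ring_closure]
  refine le_antisymm (Subring.closure_mono Set.subset_union_right) (Subring.closure_le.mpr ?_)
  rintro x (⟨c, rfl⟩ | hx)
  · exact Subring.subset_closure (Or.inl (R.algebraMap_mem c))
  · exact Subring.subset_closure hx

/-- `Algebra.adjoin k (R ∪ t)` is finitely generated when `R` is and `t` is finite. [folklore] -/
theorem fg_adjoin_subalgebra_union (R : Subalgebra k K) (hfg : R.FG) (t : Finset K) :
    (Algebra.adjoin k ((R : Set K) ∪ ↑t)).FG := by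
  rw [Algebra.adjoin_union, Algebra.adjoin_eq R]
  exact hfg.sup (Subalgebra.fg_adjoin_finset t)

/-- **Towers of local blowing ups vs. finitely generated models.** For a finitely generated
`k`-subalgebra `R ⊆ O` of `K`: some tower of local blowing ups with respect to `O`
(`IsLocalBlowup O`, Novacoski–Spivakovsky Def. 2.8) starting at `R` ends with a regular local
ring (Def. 2.20) iff some finitely generated `k`-subalgebra `A` with `R ≤ A ⊆ O` is regular at
the centre `𝔪_O ∩ A` (the conclusion shape of `RelLocalUniformization`).
[cite: NovacoskiSpivakovsky2014, Def. 2.20 and Lemma 2.9] -/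
theorem towerLU_iff_fgModel (O : ValuationSubring K) (R : Subalgebra k K) (hfg : R.FG)
    (hRO : R.toSubring ≤ O.toSubring) :
    (∃ B' : Subring K, Relation.ReflTransGen (IsLocalBlowup O) R.toSubring B' ∧
      locAtCentre B' O = B' ∧ IsRegularLocalRing B') ↔
    ∃ (A : Subalgebra k K) (h : A.toSubring ≤ O.toSubring), R ≤ A ∧ A.FG ∧
      IsRegularLocalRing (Localization.AtPrime
        (Ideal.comap (Subring.inclusion h) (IsLocalRing.maximalIdeal O))) := by
  rw [lu_tower_iff_fg hRO]
  constructor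
  · rintro ⟨t, h, hreg⟩
    have e := closure_subalgebra_union_eq R (↑t : Set K)
    have h' : (Algebra.adjoin k ((R : Set K) ∪ ↑t)).toSubring ≤ O.toSubring := e ▸ h
    refine ⟨Algebra.adjoin k ((R : Set K) ∪ ↑t), h', ?_, fg_adjoin_subalgebra_union R hfg t, ?_⟩
    · exact fun x hx => Algebra.subset_adjoin (Or.inl hx)
    · exact (isRegularLocalRing_centre_congr e h h').mp hreg
  · rintro ⟨A, h, hRA, ⟨s, hs⟩, hreg⟩
    have e : Subring.closure ((R : Set K) ∪ ↑s) = A.toSubring := by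
      rw [closure_subalgebra_union_eq]
      congr 1
      refine le_antisymm (Algebra.adjoin_le (Set.union_subset hRA ?_)) ?_
      · rw [← hs]; exact Algebra.subset_adjoin
      · rw [← hs]
        exact Algebra.adjoin_mono Set.subset_union_right
    have h' : Subring.closure ((R : Set K) ∪ ↑s) ≤ O.toSubring := e ▸ h
    exact ⟨s, h', (isRegularLocalRing_centre_congr e h' h).mpr hreg⟩

/-- **`RelLocalUniformization k K O` is Novacoski–Spivakovsky's Def. 2.20 for `ν_O`** at every
finitely generated model of `K/k` inside `O`: every finitely generated `k`-subalgebra `R ⊆ O`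
with `Frac R = K` starts a tower of local blowing ups with respect to `O` ending with a regular
local ring. [cite: NovacoskiSpivakovsky2014, Def. 2.20] -/
theorem relLocalUniformization_iff_towers (O : ValuationSubring K) :
    RelLocalUniformization k K O ↔
      ∀ R : Subalgebra k K, R.FG → IsFractionRing R K → R.toSubring ≤ O.toSubring →
        ∃ B' : Subring K, Relation.ReflTransGen (IsLocalBlowup O) R.toSubring B' ∧
          locAtCentre B' O = B' ∧ IsRegularLocalRing B' := by
  refine forall_congr' fun R => forall_congr' fun hfg => forall_congr' fun _ =>
    forall_congr' fun hRO => ?_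
  rw [towerLU_iff_fgModel O R hfg hRO]

end Literature.AlgebraicGeometry.Resolution

end
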